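/- Copyright: the b2b-balaban cell (near-miss cell 7), T⁴-continuum fan-out, lineage t4-ne7b-p1 (node U5c COUNT
member).  Released under the licence of the surrounding project. -/
import Summits.QuantumFields.BalabanUV.T4Continuum.Support.HistoryRealiseCells
import Literature.MathematicalPhysics.QuantumFieldTheory.Balaban1983to89.B16OverhangN

/-!
# M5-1b (A1) — BIRTH ANCHORS: the maximal domain of a birth family, the young ∕ dead split of its volume, the
transport of the dead births' anchors to an earlier footprint, and that footprint's decay (owner module of row NE7b,
lineage `t4-ne7b-p1` gen 43; re-open object (α), `SCOPE-alpha.md` v2.6, ruling R-OWNER-43-1 «THE FLAT ANCHOR LEDGER»;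
PRE-POSITIONING ONLY)

Summits-side support leaf of the T⁴-continuum cell (rung (B)+1 on a FINITE torus only; NOT infinite volume, NOT the
mass gap, NOT the Clay statement; NOT a proof of the spine estimate NE7b, which is the cell's OWN estimate, NOT PRINTED
and NOT PROVED).  [folklore] finite combinatorics on `ℤᵈ` over the b02 lineage's index model of the operation `S`
(`Balaban1983to89.B16SProfile`: `Sop`, `Siter`, `ratio`, `DropCtl`, `box`, `card_box`; `B13ScaleTransfer.coarse` ∕
`closureIdx`), the lineage's orbit vocabulary (`HistoryRealise.orbit`, `HistoryRealiseCells.Qfrom`,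
`coarse_Qfrom_mem_orbit`, `Qfrom_sub_split`), and — REUSED BY NAME — b02's `B16OverhangN.Siter_subset_box_of_condI` (a
region whose orbit has met condition (i) stays in a radius-`280` box about the coarse image of any of its cubes),
`B16OverhangN.card_closureIdx_le_decay` (the cover count of a reference domain decays like `2^{−i}` down to one cube),
`B16OverhangN.faceConnected_Sop_of_touchConnected`, `B16OverhangN.card_Sop_le`, `TreeLength.treeLen_le_card_sub_one`;
nothing printed is asserted, no `def … : Prop` fact of Bałaban's is minted, no cite-tagged hypothesis, zero `sorry`.
Two `def`s (`MD`, `banchor`) name finite sets ∕ points of the index model; they introduce no notion of Bałaban's.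
B16 = [Balaban1989LargeFieldII] pp. 384–387 under audit; locators only.

WHY (ruling R-OWNER-43-1, journal «RULING R-OWNER-43-1», amending R-OWNER-42-3 (2)–(4)).  M5-1 must read a live
structure's realised volume cost `Σ_m u_m·#(domains at m)` below the END's booked `costT` in TOTAL form
(R-OWNER-42-2).  The nested junction (a budget per join level, b02's `Step.Budget` calculus) charges one overhang floor
per nested level per step, which the END's DEFERRED merger windows do not perform; the FLAT ledger charges, at every step
`m`, (Y) the images of the YOUNG births (each inside its own booked window — M5-1a `HistoryBankingVolumeProfile`),
plus (D) `561^d` cubes per ANCHOR of a dead birth (a birth region whose own orbit has met condition (i) stays in a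
radius-`280` box about its anchor — b02), and bounds the anchors at scale `m` by the FOOTPRINT, `j` steps coarser, of
the structure's maximal domains at time `m − j` (one decaying term per component alive at `m − j`, plus one anchor per
birth younger than `j`) — a GLOBAL reserve `ε_j·TOTAL` in place of per-component budgets.  THIS FILE supplies the
birth-family geometry of that ledger, generic over an index type `β` of births with steps `jb`, regions `Zb ⊆ ℤᵈ` (the
lattice of the birth scale) and anchor cubes `cb b ∈ Zb b` (the tag's `zZ.1 ∈ zZ.2` of `HistoryRealise.Realises`), along
the flow `(L, s)` of the lineage's orbits: §1 **`MD`** — the maximal domain of a birth family at time `t` (the union of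
the births' orbits; the realised domain of every component lies inside the maximal domain of its births, (G-join) ⊆),
its one-step recursion `MD_succ` (apply `S`, add the newborn), monotonicity and additivity in the family; §2 **dead
births**: `orbit_subset_box_of_condI` ∕ `card_orbit_le_of_condI` (b02's box lemma in orbit vocabulary: after condition (i)
the orbit stays in `box (banchor b m) 280`, `≤ 561^d` cubes); §3 **`card_MD_le_young_add_anchors`**: for any supplied
set `D` of dead births, `#MD T m ≤ Σ_{b ∈ T∖D, jb b ≤ m} #orbit_b(m) + 561^d·#(anchors of D at m)`; §4 **anchor
transport** `banchor_mem_closureIdx_MD`: the anchor at scale `m` of a birth `b` with `jb b ≤ t ≤ m` lies in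
`closureIdx (Qfrom L s t (m−t)) (MD T t)` for every family `T ∋ b` — so the anchors of the old births of a family
partitioned into groups (the components at time `t`) lie in the union of the groups' footprints
(`card_anchors_le_groups`); §5 **footprint decay** `card_closureIdx_Qfrom_le` (b02's `card_closureIdx_le_decay` along the
flow read from `t`, for a TOUCH-connected reference; `treeLen S(Z) + 1 ≤ 21^d·#Z`): `#closureIdx (Qfrom L s t i) Z ≤
2^d·(16·21^d·#Z ∕ 2^i + 1)`; §6 the assembled PER-STEP INEQUALITY of the flat ledger, `card_MD_le_flat`; §7 sanity.

WHAT IS *NOT* DONE HERE.  The lagged SUM over steps (A2 `HistoryBankingFlatLedger`: `TOTAL·(1−ε_j) ≤ YOUNG + FLOOR +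
FEE`), and the junction A3 over the lineage's realised pedigrees (components per time and the partition of births,
touch-connectedness of the components' maximal domains by induction over `RealisesW` ∕ the pass-V objects, `Gen.covers`
⇒ one performed floor per component-step, M5-1a ⇒ the young images, the reading display `u_t·Φ ≤ E₂R_t^{q′}`).  HONEST:
index-model bookkeeping; NE7b NOT proved; spine 0∕9.  HONEST DEPENDENCY (cell): continuum YM on T⁴ ⇐ BetaPertH ∧ nine
spine estimates (0∕9 proved); BetaPertH ⇐ (D1) ∧ (D4) ∧ CAP+tail.  This file changes none of it.
-/

open Finset
open Literature.MathematicalPhysics.QuantumFieldTheory.Balaban1983to89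
open Literature.MathematicalPhysics.QuantumFieldTheory.Balaban1983to89.B13ScaleTransfer
open Literature.MathematicalPhysics.QuantumFieldTheory.Balaban1983to89.TreeLength
open Literature.MathematicalPhysics.QuantumFieldTheory.Balaban1983to89.B16SProfile
open Literature.MathematicalPhysics.QuantumFieldTheory.Balaban1983to89.B16MergeGeometry
open Literature.MathematicalPhysics.QuantumFieldTheory.Balaban1983to89.B16StoppingRule
open Literature.MathematicalPhysics.QuantumFieldTheory.Balaban1983to89.B16MergeHorizon
open Literature.MathematicalPhysics.QuantumFieldTheory.Balaban1983to89.B16OverhangN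
open Summit.QuantumFields.BalabanUV.T4Continuum.HistoryRealise
open Summit.QuantumFields.BalabanUV.T4Continuum.HistoryRealiseCells

namespace Summit.QuantumFields.BalabanUV.T4Continuum.HistoryBankingAnchors

noncomputable section

variable {d : ℕ} {β : Type*}

/-! ## §1 The maximal domain of a birth family -/

section MaxDomain

variable (L : ℕ) (s : ℕ → ℕ) (jb : β → ℕ) (Zb : β → Finset (Pt d))

/-- **THE MAXIMAL DOMAIN OF A BIRTH FAMILY `T` AT TIME `t`**: the union of the orbits, `t − jb b` steps on, of the
regions of the births of `T` that have happened by `t`.  The realised domain of a component whose births are `T` lies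
inside it ((G-birth) =, (G-flow) =, (G-join) ⊆, renewal =). [folklore] -/
def MD (T : Finset β) (t : ℕ) : Finset (Pt d) :=
  (T.filter fun b => jb b ≤ t).biUnion fun b => orbit L s (jb b) (Zb b) (t - jb b)

variable {L s jb Zb}

/-- membership in the maximal domain [folklore] -/
theorem mem_MD {T : Finset β} {t : ℕ} {y : Pt d} :
    y ∈ MD L s jb Zb T t ↔ ∃ b ∈ T, jb b ≤ t ∧ y ∈ orbit L s (jb b) (Zb b) (t - jb b) := by
  unfold MD
  simp only [Finset.mem_biUnion, Finset.mem_filter]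
  exact ⟨fun ⟨b, ⟨hb, hj⟩, hy⟩ => ⟨b, hb, hj, hy⟩, fun ⟨b, hb, hj, hy⟩ => ⟨b, ⟨hb, hj⟩, hy⟩⟩

/-- a birth's orbit lies in the maximal domain of any family containing it [folklore] -/
theorem orbit_subset_MD {T : Finset β} {b : β} (hb : b ∈ T) {t : ℕ} (hj : jb b ≤ t) :
    orbit L s (jb b) (Zb b) (t - jb b) ⊆ MD L s jb Zb T t :=
  fun _ hy => mem_MD.2 ⟨b, hb, hj, hy⟩

/-- the maximal domain is monotone in the family [folklore] -/
theorem MD_mono {T T' : Finset β} (h : T ⊆ T') (t : ℕ) : MD L s jb Zb T t ⊆ MD L s jb Zb T' t :=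
  fun _ hy => by
    obtain ⟨b, hb, hj, hy⟩ := mem_MD.1 hy
    exact mem_MD.2 ⟨b, h hb, hj, hy⟩

/-- the maximal domain is additive in the family [folklore] -/
theorem MD_union [DecidableEq β] (T T' : Finset β) (t : ℕ) :
    MD L s jb Zb (T ∪ T') t = MD L s jb Zb T t ∪ MD L s jb Zb T' t := by
  ext y
  simp only [mem_MD, Finset.mem_union]
  constructor
  · rintro ⟨b, hb | hb, hj, hy⟩
    · exact Or.inl ⟨b, hb, hj, hy⟩
    · exact Or.inr ⟨b, hb, hj, hy⟩
  · rintro (⟨b, hb, hj, hy⟩ | ⟨b, hb, hj, hy⟩)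
    · exact ⟨b, Or.inl hb, hj, hy⟩
    · exact ⟨b, Or.inr hb, hj, hy⟩

/-- the maximal domain of a family lies in the union of the maximal domains of groups covering its births that have
happened [folklore] -/
theorem MD_subset_biUnion_groups {ι : Type*} {T : Finset β} {G : Finset ι} {Tg : ι → Finset β} {t : ℕ}
    (hcov : ∀ b ∈ T, jb b ≤ t → ∃ x ∈ G, b ∈ Tg x) :
    MD L s jb Zb T t ⊆ G.biUnion fun x => MD L s jb Zb (Tg x) t := by
  intro y hy
  obtain ⟨b, hb, hj, hy⟩ := mem_MD.1 hy
  obtain ⟨x, hx, hbx⟩ := hcov b hb hj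
  exact Finset.mem_biUnion.2 ⟨x, hx, mem_MD.2 ⟨b, hbx, hj, hy⟩⟩

/-- one step of a birth's orbit past time `t ≥ jb b` is the operation `S` at step `t` [folklore] -/
theorem orbit_step {j t : ℕ} (hj : j ≤ t) (Z : Finset (Pt d)) :
    orbit L s j Z (t + 1 - j) = Sop (ratio L s t) (orbit L s j Z (t - j)) := by
  rw [show t + 1 - j = (t - j) + 1 by omega, orbit_succ, ratio_shift, show j + (t - j) = t by omega]

/-- **THE ONE-STEP RECURSION OF THE MAXIMAL DOMAIN**: `MD T (t+1) = S_t(MD T t) ∪ ⋃_{jb b = t+1} Zb b` — the maximal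
domain is a PROCESS: apply the operation `S` of step `t`, add the newborn regions. [folklore] -/
theorem MD_succ (T : Finset β) (t : ℕ) :
    MD L s jb Zb T (t + 1) =
      Sop (ratio L s t) (MD L s jb Zb T t) ∪ (T.filter fun b => jb b = t + 1).biUnion Zb := by
  ext y
  simp only [mem_MD, Finset.mem_union, Finset.mem_biUnion, Finset.mem_filter]
  constructor
  · rintro ⟨b, hb, hj, hy⟩
    rcases Nat.lt_or_ge (jb b) (t + 1) with hlt | hge
    · left
      have hj' : jb b ≤ t := by omega
      rw [orbit_step hj'] at hy
      unfold MD
      rw [Sop_biUnion, Finset.mem_biUnion]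
      exact ⟨b, Finset.mem_filter.2 ⟨hb, hj'⟩, hy⟩
    · right
      have he : jb b = t + 1 := le_antisymm hj hge
      rw [he, Nat.sub_self, orbit_zero] at hy
      exact ⟨b, ⟨hb, he⟩, hy⟩
  · rintro (hy | ⟨b, ⟨hb, he⟩, hy⟩)
    · unfold MD at hy
      rw [Sop_biUnion, Finset.mem_biUnion] at hy
      obtain ⟨b, hb, hy⟩ := hy
      rw [Finset.mem_filter] at hb
      refine ⟨b, hb.1, by omega, ?_⟩
      rwa [orbit_step hb.2]
    · refine ⟨b, hb, by omega, ?_⟩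
      rwa [he, Nat.sub_self, orbit_zero]

end MaxDomain

/-! ## §2 Dead births: after condition (i) the orbit stays in a radius-`280` box about its anchor -/

section Dead

variable (L : ℕ) (s : ℕ → ℕ) (jb : β → ℕ) (cb : β → Pt d)

/-- **THE ANCHOR OF A BIRTH AT SCALE `m`**: the coarse image, `m − jb b` steps on along the flow read from the birth
step, of the birth's anchor cube `cb b`. [folklore] -/
def banchor (b : β) (m : ℕ) : Pt d := coarse (Qfrom L s (jb b) (m - jb b)) (cb b)

variable {L s jb cb}

/-- **A DEAD ORBIT STAYS IN A BOX** (b02's `Siter_subset_box_of_condI` in orbit vocabulary): along a flow with `L ≥ 2`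
and drop control on every horizon, if the orbit of `Z` formed at `j` meets condition (i) at the relative index `a`,
then at every later index `l ≥ a` it lies in `box (coarse (Qfrom L s j l) c) 280` for every cube `c ∈ Z`.
[folklore] -/
theorem orbit_subset_box_of_condI (hL : 2 ≤ L) (hdrop : ∀ m, DropCtl s m) {j : ℕ} {Z : Finset (Pt d)} {c : Pt d}
    (hc : c ∈ Z) {a l : ℕ} (hI : CondI 100 (orbit L s j Z a)) (hal : a ≤ l) :
    orbit L s j Z l ⊆ box (coarse (Qfrom L s j l) c) 280 := by
  have h := Siter_subset_box_of_condI hL (dropCtl_from hdrop j l) hc (a := a) hI (l - a) (by omega)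
  rw [show a + (l - a) = l by omega] at h
  exact h

/-- hence a dead orbit has at most `561^d` cubes [folklore] -/
theorem card_orbit_le_of_condI (hL : 2 ≤ L) (hdrop : ∀ m, DropCtl s m) {j : ℕ} {Z : Finset (Pt d)} {c : Pt d}
    (hc : c ∈ Z) {a l : ℕ} (hI : CondI 100 (orbit L s j Z a)) (hal : a ≤ l) :
    (orbit L s j Z l).card ≤ 561 ^ d := by
  have h := Finset.card_le_card (orbit_subset_box_of_condI hL hdrop hc hI hal)
  rw [card_box] at h
  simpa using h

/-- the dead orbit of a birth at time `m` lies in the box about its anchor at scale `m` [folklore] -/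
theorem orbit_subset_box_banchor (hL : 2 ≤ L) (hdrop : ∀ m, DropCtl s m) {Zb : β → Finset (Pt d)} {b : β}
    (hc : cb b ∈ Zb b) {m a : ℕ} (hI : CondI 100 (orbit L s (jb b) (Zb b) a)) (ham : a ≤ m - jb b) :
    orbit L s (jb b) (Zb b) (m - jb b) ⊆ box (banchor L s jb cb b m) 280 :=
  orbit_subset_box_of_condI hL hdrop hc hI ham

end Dead

/-! ## §3 The per-step volume bound with a supplied set of dead births -/

section Volume

variable {L : ℕ} {s : ℕ → ℕ} {jb : β → ℕ} {Zb : β → Finset (Pt d)} {cb : β → Pt d}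

/-- **YOUNG IMAGES PLUS `561^d` PER ANCHOR.**  For a birth family `T` at time `m` and any supplied set `D ⊆ T` of births
that have happened and whose orbits have met condition (i) by `m` (`hdead`), with anchor cubes inside their regions
(`hc`): `#MD T m ≤ Σ_{b ∈ T∖D, jb b ≤ m} #orbit_b(m) + 561^d·#(D.image (banchor · m))` — dead births sharing an anchor
are paid ONCE (coalescence). [folklore] -/
theorem card_MD_le_young_add_anchors [DecidableEq β] (hL : 2 ≤ L) (hdrop : ∀ m, DropCtl s m) (T : Finset β)
    (m : ℕ) (D : Finset β)
    (hdead : ∀ b ∈ D, jb b ≤ m ∧ ∃ a, a ≤ m - jb b ∧ CondI 100 (orbit L s (jb b) (Zb b) a))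
    (hc : ∀ b ∈ D, cb b ∈ Zb b) :
    (MD L s jb Zb T m).card ≤
      (∑ b ∈ (T \ D).filter (fun b => jb b ≤ m), (orbit L s (jb b) (Zb b) (m - jb b)).card)
        + 561 ^ d * (D.image fun b => banchor L s jb cb b m).card := by
  classical
  have hsplit : MD L s jb Zb T m ⊆ MD L s jb Zb (T \ D) m ∪ (D.image fun b => banchor L s jb cb b m).biUnion
      (fun p => box p 280) := by
    intro y hy
    obtain ⟨b, hb, hj, hyb⟩ := mem_MD.1 hy
    rw [Finset.mem_union]
    by_cases hbD : b ∈ D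
    · right
      obtain ⟨-, a, ha, hI⟩ := hdead b hbD
      rw [Finset.mem_biUnion]
      exact ⟨banchor L s jb cb b m, Finset.mem_image_of_mem _ hbD,
        orbit_subset_box_banchor hL hdrop (hc b hbD) hI ha hyb⟩
    · left
      exact mem_MD.2 ⟨b, Finset.mem_sdiff.2 ⟨hb, hbD⟩, hj, hyb⟩
  have h1 : (MD L s jb Zb (T \ D) m).card ≤
      ∑ b ∈ (T \ D).filter (fun b => jb b ≤ m), (orbit L s (jb b) (Zb b) (m - jb b)).card := by
    unfold MD; exact Finset.card_biUnion_le
  have h2 : ((D.image fun b => banchor L s jb cb b m).biUnion (fun p => box p 280)).card ≤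
      561 ^ d * (D.image fun b => banchor L s jb cb b m).card := by
    refine Finset.card_biUnion_le.trans ?_
    rw [Finset.sum_const_nat (m := 561 ^ d) fun p _ => by norm_num [card_box], Nat.mul_comm]
  exact (Finset.card_le_card hsplit).trans ((Finset.card_union_le _ _).trans (Nat.add_le_add h1 h2))

end Volume

/-! ## §4 Anchor transport: anchors at scale `m` lie in the footprint of the maximal domain at an earlier time -/

section Transport

variable {L : ℕ} {s : ℕ → ℕ} {jb : β → ℕ} {Zb : β → Finset (Pt d)} {cb : β → Pt d}

/-- **ANCHOR TRANSPORT.**  For a birth `b ∈ T` with its anchor cube in its region and `jb b ≤ t ≤ m`: the anchor at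
scale `m` is the coarse image, `m − t` steps on from `t`, of a cube of the maximal domain `MD T t` — it lies in the
FOOTPRINT `closureIdx (Qfrom L s t (m − t)) (MD T t)`. [folklore] -/
theorem banchor_mem_closureIdx_MD {T : Finset β} {b : β} (hb : b ∈ T) (hc : cb b ∈ Zb b) {t m : ℕ}
    (hjt : jb b ≤ t) (htm : t ≤ m) :
    banchor L s jb cb b m ∈ closureIdx (Qfrom L s t (m - t)) (MD L s jb Zb T t) := by
  unfold banchor closureIdx
  rw [Qfrom_sub_split L s hjt htm, ← coarse_coarse]
  exact Finset.mem_image_of_mem _ (orbit_subset_MD hb hjt (coarse_Qfrom_mem_orbit L s (jb b) hc _))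

/-- hence the anchors at scale `m` of the births of `T` that happened by `t` lie in that footprint [folklore] -/
theorem image_banchor_subset_closureIdx_MD [DecidableEq β] {T : Finset β} (hc : ∀ b ∈ T, cb b ∈ Zb b) {t m : ℕ}
    (htm : t ≤ m) [DecidablePred fun b => jb b ≤ t] :
    ((T.filter fun b => jb b ≤ t).image fun b => banchor L s jb cb b m) ⊆
      closureIdx (Qfrom L s t (m - t)) (MD L s jb Zb T t) := by
  intro p hp
  obtain ⟨b, hb, rfl⟩ := Finset.mem_image.1 hp
  rw [Finset.mem_filter] at hb
  exact banchor_mem_closureIdx_MD hb.1 (hc b hb.1) hb.2 htm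

/-- **ANCHORS AGAINST GROUPS.**  If the births of `D` that happened by `t` are covered by groups `Tg x` (`x ∈ G`; the
components at time `t`), then the number of distinct anchors of `D` at scale `m ≥ t` is at most the total footprint
count of the groups' maximal domains at `t`, plus the number of births of `D` after `t`. [folklore] -/
theorem card_anchors_le_groups [DecidableEq β] {ι : Type*} {D : Finset β} (hc : ∀ b ∈ D, cb b ∈ Zb b) {G : Finset ι}
    {Tg : ι → Finset β} {t m : ℕ} (htm : t ≤ m) (hcov : ∀ b ∈ D, jb b ≤ t → ∃ x ∈ G, b ∈ Tg x) :
    (D.image fun b => banchor L s jb cb b m).card ≤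
      (∑ x ∈ G, (closureIdx (Qfrom L s t (m - t)) (MD L s jb Zb (Tg x) t)).card)
        + (D.filter fun b => t < jb b).card := by
  classical
  have hsplit : (D.image fun b => banchor L s jb cb b m) ⊆
      (G.biUnion fun x => closureIdx (Qfrom L s t (m - t)) (MD L s jb Zb (Tg x) t)) ∪
        ((D.filter fun b => t < jb b).image fun b => banchor L s jb cb b m) := by
    intro p hp
    obtain ⟨b, hb, rfl⟩ := Finset.mem_image.1 hp
    rw [Finset.mem_union]
    rcases Nat.lt_or_ge t (jb b) with hlt | hge
    · exact Or.inr (Finset.mem_image_of_mem _ (Finset.mem_filter.2 ⟨hb, hlt⟩))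
    · obtain ⟨x, hx, hbx⟩ := hcov b hb hge
      exact Or.inl (Finset.mem_biUnion.2 ⟨x, hx, banchor_mem_closureIdx_MD hbx (hc b hb) hge htm⟩)
  refine (Finset.card_le_card hsplit).trans ((Finset.card_union_le _ _).trans (Nat.add_le_add ?_ ?_))
  · exact Finset.card_biUnion_le
  · exact Finset.card_image_le

end Transport

/-! ## §5 Footprint decay of a touch-connected reference domain (b02 by name, orbit ∕ `Qfrom` vocabulary) -/

section Decay

variable {L : ℕ} {s : ℕ → ℕ}

/-- the accumulated ratio from `t` is b02's `Qprod` of the flow read from `t` (definitional) [folklore] -/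
theorem Qfrom_eq_Qprod (L : ℕ) (s : ℕ → ℕ) (t i : ℕ) : Qfrom L s t i = Qprod (ratio L fun l => s (t + l)) i := rfl

/-- **FOOTPRINT DECAY** (b02's `card_closureIdx_le_decay` along the flow read from `t`): for a non-empty TOUCH-connected
reference `Z` at time `t`, `L ≥ 4`, drop control on every horizon, and `i ≥ 1`:
`#closureIdx (Qfrom L s t i) Z ≤ 2^d·(16·treeLen S_t(Z)∕2^i + 1)`. [folklore] -/
theorem card_closureIdx_Qfrom_le (hL : 4 ≤ L) (hdrop : ∀ m, DropCtl s m) {Z : Finset (Pt d)} (hZ : Z.Nonempty)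
    (hZc : TouchConnected Z) (t : ℕ) {i : ℕ} (hi : 1 ≤ i) :
    ((closureIdx (Qfrom L s t i) Z).card : ℝ) ≤ 2 ^ d * (16 * treeLen (Sop (ratio L s t) Z) / 2 ^ i + 1) := by
  have hq : 0 < ratio L (fun l => s (t + l)) 0 := ratio_pos (by omega) _ 0
  have h := card_closureIdx_le_decay hL (dropCtl_from hdrop t i) hZ (faceConnected_Sop_of_touchConnected hq hZc) hi
    le_rfl
  rwa [Qfrom_eq_Qprod]

/-- `treeLen S_t(Z) + 1 ≤ 21^d·#Z` for a non-empty touch-connected `Z` (`L ≥ 1`). [folklore] -/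
theorem treeLen_Sop_add_one_le (hL : 1 ≤ L) {Z : Finset (Pt d)} (hZ : Z.Nonempty) (hZc : TouchConnected Z)
    (t : ℕ) : treeLen (Sop (ratio L s t) Z) + 1 ≤ 21 ^ d * (Z.card : ℝ) := by
  have hq : 0 < ratio L s t := ratio_pos (by omega) s t
  have h1 := treeLen_le_card_sub_one (Sop_nonempty (ratio L s t) hZ) (faceConnected_Sop_of_touchConnected hq hZc)
  have h2 : ((Sop (ratio L s t) Z).card : ℝ) ≤ 21 ^ d * (Z.card : ℝ) := by exact_mod_cast card_Sop_le (ratio L s t) Z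
  linarith

/-- **FOOTPRINT DECAY IN VOLUME FORM**: `#closureIdx (Qfrom L s t i) Z ≤ 2^d·(16·21^d·#Z∕2^i + 1)` (`i ≥ 1`). [folklore] -/
theorem card_closureIdx_Qfrom_le_card (hL : 4 ≤ L) (hdrop : ∀ m, DropCtl s m) {Z : Finset (Pt d)} (hZ : Z.Nonempty)
    (hZc : TouchConnected Z) (t : ℕ) {i : ℕ} (hi : 1 ≤ i) :
    ((closureIdx (Qfrom L s t i) Z).card : ℝ) ≤ 2 ^ d * (16 * (21 ^ d * (Z.card : ℝ)) / 2 ^ i + 1) := by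
  have h1 := card_closureIdx_Qfrom_le hL hdrop hZ hZc t hi
  have h2 := treeLen_Sop_add_one_le (s := s) (show 1 ≤ L by omega) hZ hZc t
  have h3 : treeLen (Sop (ratio L s t) Z) ≤ 21 ^ d * (Z.card : ℝ) := by linarith
  have h4 : (16 : ℝ) * treeLen (Sop (ratio L s t) Z) / 2 ^ i ≤ 16 * (21 ^ d * (Z.card : ℝ)) / 2 ^ i :=
    div_le_div_of_nonneg_right (by linarith) (by positivity)
  have h5 : (0 : ℝ) ≤ 2 ^ d := by positivity
  nlinarith [mul_le_mul_of_nonneg_left h4 h5]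

end Decay

/-! ## §6 The per-step inequality of the flat ledger, assembled -/

section Flat

variable {L : ℕ} {s : ℕ → ℕ} {jb : β → ℕ} {Zb : β → Finset (Pt d)} {cb : β → Pt d}

/-- **THE PER-STEP INEQUALITY OF THE FLAT LEDGER** (ruling R-OWNER-43-1 (c)).  Birth family `T` with anchor cubes in
the regions; a supplied set `D ⊆ T` of births dead by `m` (condition (i) met on their own orbits); a lag time `t ≤ m`
with `m − t ≥ 1`; groups `Tg x` (`x ∈ G`, the components at time `t`) covering the births of `D` up to `t`, each with a
non-empty TOUCH-connected maximal domain at `t`; flow `L ≥ 4` with drop control on every horizon.  Then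
`#MD T m ≤ Σ_{b ∈ T∖D, jb b ≤ m} #orbit_b(m) + 561^d·(Σ_{x∈G} 2^d·(16·21^d·#MD(Tg x, t)∕2^{m−t} + 1) + #{b ∈ D : t <
jb b})` — young images, one decaying footprint term per component at the lag time, one anchor per recent dead birth.
[folklore] -/
theorem card_MD_le_flat [DecidableEq β] {ι : Type*} (hL : 4 ≤ L) (hdrop : ∀ m, DropCtl s m) (T : Finset β)
    {m t : ℕ} (htm : t + 1 ≤ m) (D : Finset β)
    (hdead : ∀ b ∈ D, jb b ≤ m ∧ ∃ a, a ≤ m - jb b ∧ CondI 100 (orbit L s (jb b) (Zb b) a))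
    (hc : ∀ b ∈ D, cb b ∈ Zb b) {G : Finset ι} {Tg : ι → Finset β}
    (hcov : ∀ b ∈ D, jb b ≤ t → ∃ x ∈ G, b ∈ Tg x)
    (hne : ∀ x ∈ G, (MD L s jb Zb (Tg x) t).Nonempty) (htc : ∀ x ∈ G, TouchConnected (MD L s jb Zb (Tg x) t)) :
    ((MD L s jb Zb T m).card : ℝ) ≤
      (∑ b ∈ (T \ D).filter (fun b => jb b ≤ m), ((orbit L s (jb b) (Zb b) (m - jb b)).card : ℝ))
        + 561 ^ d * ((∑ x ∈ G, 2 ^ d * (16 * (21 ^ d * ((MD L s jb Zb (Tg x) t).card : ℝ)) / 2 ^ (m - t) + 1))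
          + ((D.filter fun b => t < jb b).card : ℝ)) := by
  have h1 := card_MD_le_young_add_anchors (cb := cb) (show 2 ≤ L by omega) hdrop T m D hdead hc
  have h2 := card_anchors_le_groups (L := L) (s := s) (Zb := Zb) hc (G := G) (Tg := Tg) (show t ≤ m by omega) hcov
  have h3 : ∀ x ∈ G, ((closureIdx (Qfrom L s t (m - t)) (MD L s jb Zb (Tg x) t)).card : ℝ) ≤
      2 ^ d * (16 * (21 ^ d * ((MD L s jb Zb (Tg x) t).card : ℝ)) / 2 ^ (m - t) + 1) :=
    fun x hx => card_closureIdx_Qfrom_le_card hL hdrop (hne x hx) (htc x hx) t (by omega)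
  have h4 : ((∑ x ∈ G, (closureIdx (Qfrom L s t (m - t)) (MD L s jb Zb (Tg x) t)).card : ℕ) : ℝ) ≤
      ∑ x ∈ G, 2 ^ d * (16 * (21 ^ d * ((MD L s jb Zb (Tg x) t).card : ℝ)) / 2 ^ (m - t) + 1) := by
    push_cast
    exact Finset.sum_le_sum h3
  have h1' : ((MD L s jb Zb T m).card : ℝ) ≤
      (∑ b ∈ (T \ D).filter (fun b => jb b ≤ m), ((orbit L s (jb b) (Zb b) (m - jb b)).card : ℝ))
        + 561 ^ d * ((D.image fun b => banchor L s jb cb b m).card : ℝ) := by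
    exact_mod_cast h1
  have h2' : ((D.image fun b => banchor L s jb cb b m).card : ℝ) ≤
      ((∑ x ∈ G, (closureIdx (Qfrom L s t (m - t)) (MD L s jb Zb (Tg x) t)).card : ℕ) : ℝ)
        + ((D.filter fun b => t < jb b).card : ℝ) := by
    exact_mod_cast h2
  have h5 : (0 : ℝ) ≤ 561 ^ d := by positivity
  have h6 := mul_le_mul_of_nonneg_left (h2'.trans (add_le_add h4 le_rfl)) h5
  linarith

end Flat

/-! ## §7 Sanity: a single birth realises the young side with equality -/

/-- For a one-birth family nothing is dead before condition (i): with `D = ∅` the volume bound reads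
`#MD {b} m ≤ #orbit_b(m)`, an equality here (`d = 1`, one cube, any flow). [folklore] -/
theorem sanity_single (L : ℕ) (s : ℕ → ℕ) (m : ℕ) :
    (MD L s (fun _ : Unit => 0) (fun _ => ({fun _ => (0 : ℤ)} : Finset (Pt 1))) {()} m).card =
      (orbit L s 0 ({fun _ => (0 : ℤ)} : Finset (Pt 1)) m).card := by
  unfold MD
  simp

end

end Summit.QuantumFields.BalabanUV.T4Continuum.HistoryBankingAnchors
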